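import Literature.Analysis.FunctionSpaces.SchauderConstantCoefficient
import Literature.Analysis.FunctionSpaces.HolderAlgebra
import HarnessLib

/-!
# The local Schauder estimate for variable coefficients on `ℝⁿ` (Schauder program, B3)

Topic `Literature/Analysis/FunctionSpaces`. The freezing argument of Gilbarg–Trudinger 2001,
Lemma 6.1 / Thm. 6.2, in the form needed for patching on a closed manifold: for an orthonormal
basis `e` of `E`, `0 < α < 1` and bounds (ellipticity `λ, Λ`, Hölder data `K_a, K_b, K_c` of the
coefficients) there are `ρ₀ > 0` and `C` such that for every operator
`P u = ∑ᵢⱼ aⁱʲ D²u(eᵢ,eⱼ) + ∑ₗ bˡ Du(eₗ) + c u` whose coefficients obey the bounds on a ball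
`B(x₀, ρ)`, `ρ ≤ ρ₀`, and every `u ∈ C^{2,α}` supported in `B(x₀, ρ)`,

  `[D²u(e_p, e_q)]_α ≤ C [P u]_α`.

Freezing at `x₀` (`∑ aⁱʲ(x₀) D²ᵢⱼu = P u − ∑ (aⁱʲ − aⁱʲ(x₀)) D²ᵢⱼu − ∑ bˡ Dₗu − c u`), the
constant-coefficient estimate (`exists_schauder_const_coeff`) and the smallness of all lower-order
quantities of a function supported in a small ball (`sup |h| ≤ [h]_α (2ρ)^α`) give
`[D²u]_α ≤ C[Pu]_α + ½[D²u]_α`, which is absorbed.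

* `exists_schauder_local` — the statement above.

Census item (2a) of `Literature.Geometry.Riemannian.gurskyViaclovsky_pathOpen_weighted_four`.
Everything is proved; no named facts.

## References

* D. Gilbarg, N. S. Trudinger, *Elliptic Partial Differential Equations of Second Order* (2001),
  Lemma 6.1, Thm. 6.2. [GilbargTrudinger2001]
-/

noncomputable section

open MeasureTheory Filter Topology Function Metric
open scoped ENNReal NNReal ContDiff InnerProductSpace RealInnerProductSpace

namespace Literature.Analysis.FunctionSpaces

/-! ### Tools: Hölder bookkeeping for functions supported in a ball -/

section Tools

variable {E : Type*} [NormedAddCommGroup E] [NormedSpace ℝ E] {F : Type*} [NormedAddCommGroup F]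
  [NormedSpace ℝ F]

omit [NormedSpace ℝ F] in
/-- A Hölder (or Lipschitz, `r = 1`) function vanishing outside `B(x₀, ρ)` is bounded by
`C (2ρ)^r`. [folklore] -/
theorem norm_le_of_holderWith_of_eq_zero [Nontrivial E] {h : E → F} {C r : ℝ≥0}
    (hH : HolderWith C r h) {x₀ : E} {ρ : ℝ} (hρ : 0 < ρ) (hz : ∀ x ∉ ball x₀ ρ, h x = 0) (x : E) :
    ‖h x‖ ≤ C * (2 * ρ) ^ (r : ℝ) := by
  by_cases hx : x ∈ ball x₀ ρ
  · obtain ⟨v, hv⟩ := exists_norm_eq E hρ.le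
    have hx' : x₀ + v ∉ ball x₀ ρ := by simp [mem_ball, dist_eq_norm, hv]
    have hd : dist x (x₀ + v) ≤ 2 * ρ := by
      calc dist x (x₀ + v) ≤ dist x x₀ + dist x₀ (x₀ + v) := dist_triangle _ _ _
        _ ≤ ρ + ρ := add_le_add (mem_ball.1 hx).le (by simp [dist_eq_norm, hv])
        _ = 2 * ρ := by ring
    calc ‖h x‖ = dist (h x) (h (x₀ + v)) := by rw [hz _ hx', dist_zero_right]
      _ ≤ C * (2 * ρ) ^ (r : ℝ) := hH.dist_le_of_le hd
  · rw [hz x hx, norm_zero]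
    positivity

omit [NormedSpace ℝ E] [NormedSpace ℝ F] in
/-- Lipschitz and bounded implies `r`-Hölder for `r ≤ 1`, with constant `B + 2M`. [folklore] -/
theorem holderWith_of_dist_le_mul_of_norm_le {φ : E → F} {B M r : ℝ≥0} (hr : r ≤ 1)
    (hL : ∀ x y, dist (φ x) (φ y) ≤ B * dist x y) (hM : ∀ x, ‖φ x‖ ≤ M) :
    HolderWith (B + 2 * M) r φ := by
  refine holderWith_of_dist_le fun x y => ?_
  have hr' : (r : ℝ) ≤ 1 := by exact_mod_cast hr
  push_cast
  by_cases hd : dist x y ≤ 1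
  · have h1 : dist x y ≤ dist x y ^ (r : ℝ) := by
      conv_lhs => rw [← Real.rpow_one (dist x y)]
      exact Real.rpow_le_rpow_of_exponent_ge' dist_nonneg hd r.coe_nonneg hr'
    calc dist (φ x) (φ y) ≤ B * dist x y := hL x y
      _ ≤ B * dist x y ^ (r : ℝ) := by gcongr
      _ ≤ (B + 2 * M) * dist x y ^ (r : ℝ) := by gcongr; linarith [M.coe_nonneg]
  · push Not at hd
    have h1 : (1 : ℝ) ≤ dist x y ^ (r : ℝ) := Real.one_le_rpow hd.le r.coe_nonneg
    calc dist (φ x) (φ y) ≤ ‖φ x‖ + ‖φ y‖ := dist_le_norm_add_norm _ _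
      _ ≤ M + M := add_le_add (hM x) (hM y)
      _ = 2 * M * 1 := by ring
      _ ≤ (B + 2 * M) * dist x y ^ (r : ℝ) := by gcongr; linarith [B.coe_nonneg]

omit [NormedSpace ℝ E] in
/-- **Product rule with one factor supported in `s`**: only the data of the other factor ON `s`
enters: `[g h]_r ≤ sup_s |g| [h]_r + [g]_{r,s} sup |h|`. [folklore] -/
theorem holderWith_mul_of_eq_zero {g h : E → ℝ} {s : Set E} {Gs Gh Hs Hh r : ℝ≥0}
    (hg : ∀ x ∈ s, ‖g x‖ ≤ Gs) (hgH : HolderOnWith Gh r g s) (hh : HolderWith Hh r h)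
    (hhs : ∀ x, ‖h x‖ ≤ Hs) (hz : ∀ x ∉ s, h x = 0) :
    HolderWith (Gs * Hh + Gh * Hs) r (fun x => g x * h x) := by
  refine holderWith_of_dist_le fun x y => ?_
  have hd : 0 ≤ dist x y ^ (r : ℝ) := Real.rpow_nonneg dist_nonneg _
  push_cast
  by_cases hx : x ∈ s
  · by_cases hy : y ∈ s
    · calc dist (g x * h x) (g y * h y) = ‖g x * (h x - h y) + (g x - g y) * h y‖ := by
            rw [dist_eq_norm]; ring_nf
        _ ≤ ‖g x‖ * ‖h x - h y‖ + ‖g x - g y‖ * ‖h y‖ := by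
            refine (norm_add_le _ _).trans ?_
            rw [norm_mul, norm_mul]
        _ ≤ Gs * (Hh * dist x y ^ (r : ℝ)) + Gh * dist x y ^ (r : ℝ) * Hs := by
            gcongr
            · exact hg x hx
            · rw [← dist_eq_norm]; exact hh.dist_le x y
            · rw [← dist_eq_norm]; exact hgH.dist_le hx hy
            · exact hhs y
        _ = (Gs * Hh + Gh * Hs) * dist x y ^ (r : ℝ) := by ring
    · rw [hz y hy, mul_zero]
      calc dist (g x * h x) 0 = ‖g x‖ * ‖h x - h y‖ := by
            rw [hz y hy, sub_zero, dist_zero_right, norm_mul]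
        _ ≤ Gs * (Hh * dist x y ^ (r : ℝ)) := by
            gcongr
            · exact hg x hx
            · rw [← dist_eq_norm]; exact hh.dist_le x y
        _ = Gs * Hh * dist x y ^ (r : ℝ) := by ring
        _ ≤ Gs * Hh * dist x y ^ (r : ℝ) + Gh * Hs * dist x y ^ (r : ℝ) :=
            le_add_of_nonneg_right (by positivity)
        _ = (Gs * Hh + Gh * Hs) * dist x y ^ (r : ℝ) := by ring
  · rw [hz x hx, mul_zero]
    by_cases hy : y ∈ s
    · calc dist 0 (g y * h y) = ‖g y‖ * ‖h x - h y‖ := by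
            rw [hz x hx, zero_sub, norm_neg, dist_zero_left, norm_mul]
        _ ≤ Gs * (Hh * dist x y ^ (r : ℝ)) := by
            gcongr
            · exact hg y hy
            · rw [← dist_eq_norm]; exact hh.dist_le x y
        _ = Gs * Hh * dist x y ^ (r : ℝ) := by ring
        _ ≤ Gs * Hh * dist x y ^ (r : ℝ) + Gh * Hs * dist x y ^ (r : ℝ) :=
            le_add_of_nonneg_right (by positivity)
        _ = (Gs * Hh + Gh * Hs) * dist x y ^ (r : ℝ) := by ring
    · rw [hz y hy, mul_zero, dist_self]
      positivity

omit [NormedSpace ℝ E] [NormedSpace ℝ F] in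
/-- Hölder constants add up over finite sums. [folklore] -/
theorem holderWith_finset_sum {κ : Type*} (s : Finset κ) {f : κ → E → F} {C : κ → ℝ≥0} {r : ℝ≥0}
    (h : ∀ k ∈ s, HolderWith (C k) r (f k)) :
    HolderWith (∑ k ∈ s, C k) r (fun x => ∑ k ∈ s, f k x) := by
  classical
  induction s using Finset.induction_on with
  | empty => simp only [Finset.sum_empty]; exact HolderWith.zero
  | insert a s ha ih =>
    simp only [Finset.sum_insert ha]
    have h1 := h a (Finset.mem_insert_self a s)
    have h2 := ih fun k hk => h k (Finset.mem_insert_of_mem hk)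
    exact h1.add h2

/-- Mean value: a derivative bound gives a Lipschitz bound. [folklore] -/
theorem dist_le_mul_of_norm_fderiv_le {φ : E → F} (hφ : Differentiable ℝ φ) {B : ℝ}
    (hB : ∀ z, ‖fderiv ℝ φ z‖ ≤ B) (x y : E) : dist (φ x) (φ y) ≤ B * dist x y := by
  rw [dist_eq_norm, dist_eq_norm]
  exact convex_univ.norm_image_sub_le_of_norm_fderiv_le (fun z _ => hφ z) (fun z _ => hB z)
    (Set.mem_univ y) (Set.mem_univ x)

omit [NormedSpace ℝ F] in
/-- **Absorption of a half.** If some Hölder constant works for the family `f` and every common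
Hölder constant `C'` improves to `A + C'/2`, then `2A` works. [folklore] -/
theorem holderWith_of_forall_imp_half {κ : Type*} {X : Type*} [PseudoMetricSpace X]
    {f : κ → X → F} {r A C₀ : ℝ≥0} (h0 : ∀ k, HolderWith C₀ r (f k))
    (hstep : ∀ C' : ℝ≥0, (∀ k, HolderWith C' r (f k)) → ∀ k, HolderWith (A + C' / 2) r (f k)) :
    ∀ k, HolderWith (2 * A) r (f k) := by
  -- `2A + C₀ 2⁻ⁿ` works for every `n`
  have hn : ∀ n : ℕ, ∀ k, HolderWith (2 * A + C₀ / 2 ^ n) r (f k) := by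
    intro n
    induction n with
    | zero => intro k; exact (h0 k).mono (by simp)
    | succ n ih =>
      intro k
      refine (hstep _ ih k).mono (le_of_eq ?_)
      rw [pow_succ]
      field_simp
      ring
  intro k x y
  have hd : edist x y ^ (r : ℝ) ≠ ⊤ := ENNReal.rpow_ne_top_of_nonneg r.coe_nonneg (edist_ne_top x y)
  have hlim : Tendsto (fun n : ℕ => (((2 * A + C₀ / 2 ^ n : ℝ≥0)) : ℝ≥0∞) * edist x y ^ (r : ℝ))
      atTop (𝓝 (((2 * A : ℝ≥0) : ℝ≥0∞) * edist x y ^ (r : ℝ))) := by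
    refine ENNReal.Tendsto.mul_const (ENNReal.tendsto_coe.2 ?_) (Or.inr hd)
    have h1 : Tendsto (fun n : ℕ => C₀ / 2 ^ n) atTop (𝓝 0) := by
      have h2 : Tendsto (fun n : ℕ => ((2 : ℝ≥0)⁻¹) ^ n) atTop (𝓝 0) :=
        tendsto_pow_atTop_nhds_zero_of_lt_one (by positivity) (by norm_num)
      simpa [div_eq_mul_inv, inv_pow] using h2.const_mul C₀
    simpa using tendsto_const_nhds.add h1
  exact ge_of_tendsto' hlim fun n => hn n k x y

omit [NormedSpace ℝ E] [NormedSpace ℝ F] in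
/-- Hölder constants add under subtraction. [folklore] -/
theorem holderWith_sub {f g : E → F} {Cf Cg r : ℝ≥0} (hf : HolderWith Cf r f)
    (hg : HolderWith Cg r g) : HolderWith (Cf + Cg) r (fun x => f x - g x) := by
  refine holderWith_of_dist_le fun x y => ?_
  push_cast
  calc dist (f x - g x) (f y - g y) ≤ dist (f x) (f y) + dist (g x) (g y) := dist_sub_sub_le _ _ _ _
    _ ≤ Cf * dist x y ^ (r : ℝ) + Cg * dist x y ^ (r : ℝ) := add_le_add (hf.dist_le x y) (hg.dist_le x y)
    _ = (Cf + Cg) * dist x y ^ (r : ℝ) := by ring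

end Tools

/-! ### Derivatives in an orthonormal frame -/

section Frame

variable {ι : Type*} [Fintype ι] [DecidableEq ι] {E : Type*} [NormedAddCommGroup E]
  [InnerProductSpace ℝ E] {F : Type*} [NormedAddCommGroup F] [NormedSpace ℝ F]

omit [InnerProductSpace ℝ E] in
/-- `D(x ↦ Du(x) b)(x) a = D²u(x)(a, b)` (real version of
`fderiv_fderiv_apply_eq_iteratedFDeriv_two'`). [folklore] -/
theorem fderiv_fderiv_apply_eq_iteratedFDeriv_two_real [NormedSpace ℝ E] {u : E → F}
    (hu : ContDiff ℝ 2 u) (a b x : E) :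
    fderiv ℝ (fun y => fderiv ℝ u y b) x a = iteratedFDeriv ℝ 2 u x ![a, b] := by
  have hd : DifferentiableAt ℝ (fderiv ℝ u) x :=
    ((hu.fderiv_right (m := 1) (by norm_num)).differentiable one_ne_zero x)
  rw [fderiv_clm_apply hd (differentiableAt_const b), iteratedFDeriv_two_apply]
  simp

/-- The derivative of `x ↦ Du(x) e_l` in the frame: `∑ᵢ ⟪eᵢ, v⟫ D²u(x)(eᵢ, e_l)`. [folklore] -/
theorem fderiv_fderiv_apply_eq_sum (bE : OrthonormalBasis ι ℝ E) {u : E → ℝ} (hu : ContDiff ℝ 2 u)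
    (l : ι) (z v : E) :
    fderiv ℝ (fun y => fderiv ℝ u y (bE l)) z v =
      ∑ i, ⟪bE i, v⟫ * iteratedFDeriv ℝ 2 u z ![bE i, bE l] := by
  rw [fderiv_fderiv_apply_eq_iteratedFDeriv_two_real hu,
    iteratedFDeriv_two_eq_sum_orthonormalBasis bE u z v (bE l)]
  refine Finset.sum_congr rfl fun i _ => ?_
  simp [bE.inner_eq_ite, Finset.sum_ite_eq']

omit [DecidableEq ι] in
/-- The derivative in the frame: `Du(z) v = ∑ₗ ⟪e_l, v⟫ Du(z) e_l`. [folklore] -/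
theorem fderiv_apply_eq_sum (bE : OrthonormalBasis ι ℝ E) (u : E → F) (z v : E) :
    fderiv ℝ u z v = ∑ l, ⟪bE l, v⟫ • fderiv ℝ u z (bE l) := by
  conv_lhs => rw [← bE.sum_repr' v]
  simp only [map_sum, map_smul]

omit [DecidableEq ι] in
/-- The operator norm of `D²u(x)` from its frame entries. [folklore] -/
theorem norm_iteratedFDeriv_two_le_of_apply_le (bE : OrthonormalBasis ι ℝ E) (u : E → F) (x : E)
    {S : ℝ} (hS0 : 0 ≤ S) (hS : ∀ i j, ‖iteratedFDeriv ℝ 2 u x ![bE i, bE j]‖ ≤ S) :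
    ‖iteratedFDeriv ℝ 2 u x‖ ≤ (Fintype.card ι : ℝ) ^ 2 * S := by
  refine ContinuousMultilinearMap.opNorm_le_bound (by positivity) fun m => ?_
  have hm : iteratedFDeriv ℝ 2 u x m = iteratedFDeriv ℝ 2 u x ![m 0, m 1] := by
    congr 1
    funext i
    fin_cases i <;> rfl
  rw [hm, iteratedFDeriv_two_eq_sum_orthonormalBasis bE u x (m 0) (m 1), Fin.prod_univ_two]
  calc ‖∑ i, ∑ j, (⟪bE i, m 0⟫ * ⟪bE j, m 1⟫) • iteratedFDeriv ℝ 2 u x ![bE i, bE j]‖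
      ≤ ∑ i, ‖∑ j, (⟪bE i, m 0⟫ * ⟪bE j, m 1⟫) • iteratedFDeriv ℝ 2 u x ![bE i, bE j]‖ :=
        norm_sum_le _ _
    _ ≤ ∑ i, ∑ j, ‖(⟪bE i, m 0⟫ * ⟪bE j, m 1⟫) • iteratedFDeriv ℝ 2 u x ![bE i, bE j]‖ :=
        Finset.sum_le_sum fun i _ => norm_sum_le _ _
    _ ≤ ∑ _i : ι, ∑ _j : ι, ‖m 0‖ * ‖m 1‖ * S := by
        refine Finset.sum_le_sum fun i _ => Finset.sum_le_sum fun j _ => ?_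
        rw [norm_smul, norm_mul]
        refine mul_le_mul (mul_le_mul ?_ ?_ (norm_nonneg _) (norm_nonneg _)) (hS i j) (norm_nonneg _)
          (by positivity)
        · exact (norm_inner_le_norm _ _).trans (by rw [bE.norm_eq_one, one_mul])
        · exact (norm_inner_le_norm _ _).trans (by rw [bE.norm_eq_one, one_mul])
    _ = (Fintype.card ι : ℝ) ^ 2 * S * (‖m 0‖ * ‖m 1‖) := by
        simp only [Finset.sum_const, Finset.card_univ, nsmul_eq_mul]
        ring

end Frame

/-! ### The local estimate -/

section Local

variable {ι : Type*} [Fintype ι] [DecidableEq ι] {E : Type*} [NormedAddCommGroup E]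
  [InnerProductSpace ℝ E] [FiniteDimensional ℝ E] [MeasurableSpace E] [BorelSpace E] [Nontrivial E]

omit [FiniteDimensional ℝ E] [MeasurableSpace E] [BorelSpace E] in
/-- **One step of the freezing argument.** Under the hypotheses of `exists_schauder_local`, a
common Hölder constant `C'` for the frame entries of `D²u` improves to `C₂ [Pu]_α + C'/2`.
[cite: GilbargTrudinger2001, Lemma 6.1] -/
theorem schauder_local_step (bE : OrthonormalBasis ι ℝ E) {α : ℝ≥0} (hα1 : α ≤ 1)
    {l L : ℝ} {Ka Kb Kc C₂ : ℝ≥0}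
    (hB2 : ∀ (A : Matrix ι ι ℝ), (∀ i j, A i j = A j i) →
      (∀ ξ : ι → ℝ, l * ∑ i, ξ i ^ 2 ≤ ∑ i, ∑ j, A i j * ξ i * ξ j) →
      (∀ ξ : ι → ℝ, ∑ i, ∑ j, A i j * ξ i * ξ j ≤ L * ∑ i, ξ i ^ 2) →
      ∀ (u : E → ℝ) (M₀ M₁ M₂ : ℝ) (CL : ℝ≥0), ContDiff ℝ 2 u → (∀ x, ‖u x‖ ≤ M₀) →
        (∀ x, ‖fderiv ℝ u x‖ ≤ M₁) → (∀ x, ‖iteratedFDeriv ℝ 2 u x‖ ≤ M₂) →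
        HolderWith CL α (fun x => ∑ i, ∑ j, A i j * iteratedFDeriv ℝ 2 u x ![bE i, bE j]) →
        ∀ p q, HolderWith (C₂ * (M₀.toNNReal + CL)) α
          (fun x => iteratedFDeriv ℝ 2 u x ![bE p, bE q]))
    {ρ : ℝ} (hρ : 0 < ρ) (hρ1 : ρ ≤ 1)
    (hsmall : (C₂ : ℝ) * (Fintype.card ι : ℝ) ^ 2 * (8 + 3 * Ka + 14 * Kb + 28 * Kc) * ρ ^ (α : ℝ)
      ≤ 1 / 2)
    (a : ι → ι → E → ℝ) (b : ι → E → ℝ) (c : E → ℝ) (x₀ : E) (hsymm : ∀ i j x, a i j x = a j i x)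
    (hlow : ∀ x ∈ ball x₀ ρ, ∀ ξ : ι → ℝ, l * ∑ i, ξ i ^ 2 ≤ ∑ i, ∑ j, a i j x * ξ i * ξ j)
    (hup : ∀ x ∈ ball x₀ ρ, ∀ ξ : ι → ℝ, ∑ i, ∑ j, a i j x * ξ i * ξ j ≤ L * ∑ i, ξ i ^ 2)
    (haH : ∀ i j, HolderOnWith Ka α (a i j) (ball x₀ ρ))
    (hb0 : ∀ l' x, x ∈ ball x₀ ρ → ‖b l' x‖ ≤ Kb) (hbH : ∀ l', HolderOnWith Kb α (b l') (ball x₀ ρ))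
    (hc0 : ∀ x ∈ ball x₀ ρ, ‖c x‖ ≤ Kc) (hcH : HolderOnWith Kc α c (ball x₀ ρ))
    (u : E → ℝ) (hu : ContDiff ℝ 2 u) (hsupp : tsupport u ⊆ ball x₀ ρ) {CP : ℝ≥0}
    (hP : HolderWith CP α (fun x => (∑ i, ∑ j, a i j x * iteratedFDeriv ℝ 2 u x ![bE i, bE j]) +
      (∑ l', b l' x * fderiv ℝ u x (bE l')) + c x * u x))
    {C' : ℝ≥0} (hC' : ∀ i j, HolderWith C' α (fun x => iteratedFDeriv ℝ 2 u x ![bE i, bE j]))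
    (p q : ι) :
    HolderWith (C₂ * CP + C' / 2) α (fun x => iteratedFDeriv ℝ 2 u x ![bE p, bE q]) := by
  have hα1' : (α : ℝ) ≤ 1 := by exact_mod_cast hα1
  -- the small quantities
  set n : ℝ≥0 := (Fintype.card ι : ℝ≥0) with hn
  set ρn : ℝ≥0 := ⟨ρ, hρ.le⟩ with hρn
  have hρn_coe : (ρn : ℝ) = ρ := rfl
  have hρn1 : ρn ≤ 1 := by rw [← NNReal.coe_le_coe, hρn_coe]; exact hρ1
  set ρα : ℝ≥0 := ρn ^ (α : ℝ) with hρα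
  have hρα_coe : (ρα : ℝ) = ρ ^ (α : ℝ) := by rw [hρα, NNReal.coe_rpow, hρn_coe]
  set θ : ℝ≥0 := ρα * C' with hθ
  set S2 : ℝ≥0 := 2 * θ with hS2
  set B1 : ℝ≥0 := n * S2 with hB1
  set S1 : ℝ≥0 := 2 * ρn * B1 with hS1
  set H1 : ℝ≥0 := B1 + 2 * S1 with hH1
  set B0 : ℝ≥0 := n * S1 with hB0
  set S0 : ℝ≥0 := 2 * ρn * B0 with hS0
  set H0 : ℝ≥0 := B0 + 2 * S0 with hH0
  have hx₀ : x₀ ∈ ball x₀ ρ := mem_ball_self hρ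
  -- `u`, `Du`, `D²u` vanish outside the ball
  have hz0 : ∀ x ∉ ball x₀ ρ, u x = 0 := fun x hx =>
    image_eq_zero_of_notMem_tsupport fun h => hx (hsupp h)
  have hz1 : ∀ x ∉ ball x₀ ρ, fderiv ℝ u x = 0 := fun x hx =>
    fderiv_of_notMem_tsupport ℝ fun h => hx (hsupp h)
  have hzφ : ∀ l', ∀ x ∉ ball x₀ ρ, fderiv ℝ u x (bE l') = 0 := fun l' x hx => by
    rw [hz1 x hx]; rfl
  have hz2 : ∀ i j, ∀ x ∉ ball x₀ ρ, iteratedFDeriv ℝ 2 u x ![bE i, bE j] = 0 := fun i j x hx => by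
    have : x ∉ tsupport (iteratedFDeriv ℝ 2 u) := fun h =>
      hx (hsupp (tsupport_iteratedFDeriv_subset 2 h))
    rw [image_eq_zero_of_notMem_tsupport this]; rfl
  -- Step 1: `sup |D²ᵢⱼu| ≤ S2 = 2θ`
  have h2α : (2 * ρ) ^ (α : ℝ) ≤ 2 * ρ ^ (α : ℝ) := by
    rw [Real.mul_rpow zero_le_two hρ.le]
    gcongr
    conv_rhs => rw [← Real.rpow_one 2]
    exact Real.rpow_le_rpow_of_exponent_le one_le_two hα1'
  have hS2b : ∀ i j x, ‖iteratedFDeriv ℝ 2 u x ![bE i, bE j]‖ ≤ (S2 : ℝ) := by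
    intro i j x
    calc ‖iteratedFDeriv ℝ 2 u x ![bE i, bE j]‖ ≤ C' * (2 * ρ) ^ (α : ℝ) :=
          norm_le_of_holderWith_of_eq_zero (hC' i j) hρ (hz2 i j) x
      _ ≤ C' * (2 * ρ ^ (α : ℝ)) := by gcongr
      _ = (S2 : ℝ) := by rw [hS2, hθ]; push_cast; rw [hρα_coe]; ring
  -- Step 2: the first derivatives
  have hφd : ∀ l', Differentiable ℝ (fun z => fderiv ℝ u z (bE l')) := fun l' =>
    ((hu.fderiv_right (m := 1) (by norm_num)).differentiable one_ne_zero).clm_apply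
      (differentiable_const _)
  have hB1b : ∀ l' z, ‖fderiv ℝ (fun y => fderiv ℝ u y (bE l')) z‖ ≤ (B1 : ℝ) := by
    intro l' z
    refine ContinuousLinearMap.opNorm_le_bound _ (NNReal.coe_nonneg _) fun v => ?_
    rw [fderiv_fderiv_apply_eq_sum bE hu l' z v]
    calc ‖∑ i, ⟪bE i, v⟫ * iteratedFDeriv ℝ 2 u z ![bE i, bE l']‖
        ≤ ∑ i, ‖⟪bE i, v⟫ * iteratedFDeriv ℝ 2 u z ![bE i, bE l']‖ := norm_sum_le _ _
      _ ≤ ∑ _i : ι, ‖v‖ * (S2 : ℝ) := Finset.sum_le_sum fun i _ => by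
          rw [norm_mul]
          exact mul_le_mul ((norm_inner_le_norm _ _).trans (by rw [bE.norm_eq_one, one_mul]))
            (hS2b i l' z) (norm_nonneg _) (norm_nonneg _)
      _ = (B1 : ℝ) * ‖v‖ := by
          rw [Finset.sum_const, Finset.card_univ, nsmul_eq_mul, hB1, hn]
          push_cast
          ring
  have hL1 : ∀ l' x y, dist (fderiv ℝ u x (bE l')) (fderiv ℝ u y (bE l')) ≤ (B1 : ℝ) * dist x y :=
    fun l' => dist_le_mul_of_norm_fderiv_le (hφd l') (hB1b l')
  have hS1b : ∀ l' x, ‖fderiv ℝ u x (bE l')‖ ≤ (S1 : ℝ) := by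
    intro l' x
    have hH : HolderWith B1 1 (fun y => fderiv ℝ u y (bE l')) :=
      (LipschitzWith.of_dist_le_mul fun x y => hL1 l' x y).holderWith
    calc ‖fderiv ℝ u x (bE l')‖ ≤ B1 * (2 * ρ) ^ (((1 : ℝ≥0) : ℝ)) :=
          norm_le_of_holderWith_of_eq_zero hH hρ (hzφ l') x
      _ = (S1 : ℝ) := by rw [NNReal.coe_one, Real.rpow_one, hS1]; push_cast; rw [hρn_coe]; ring
  have hH1b : ∀ l', HolderWith H1 α (fun y => fderiv ℝ u y (bE l')) := fun l' =>
    holderWith_of_dist_le_mul_of_norm_le hα1 (hL1 l') (hS1b l')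
  -- Step 3: `u` itself
  have hud : Differentiable ℝ u := hu.differentiable (by norm_num)
  have hB0b : ∀ z, ‖fderiv ℝ u z‖ ≤ (B0 : ℝ) := by
    intro z
    refine ContinuousLinearMap.opNorm_le_bound _ (NNReal.coe_nonneg _) fun v => ?_
    rw [fderiv_apply_eq_sum bE u z v]
    calc ‖∑ l', ⟪bE l', v⟫ • fderiv ℝ u z (bE l')‖
        ≤ ∑ l', ‖⟪bE l', v⟫ • fderiv ℝ u z (bE l')‖ := norm_sum_le _ _
      _ ≤ ∑ _l : ι, ‖v‖ * (S1 : ℝ) := Finset.sum_le_sum fun l' _ => by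
          rw [norm_smul]
          exact mul_le_mul ((norm_inner_le_norm _ _).trans (by rw [bE.norm_eq_one, one_mul]))
            (hS1b l' z) (norm_nonneg _) (norm_nonneg _)
      _ = (B0 : ℝ) * ‖v‖ := by
          rw [Finset.sum_const, Finset.card_univ, nsmul_eq_mul, hB0, hn]
          push_cast
          ring
  have hL0 : ∀ x y, dist (u x) (u y) ≤ (B0 : ℝ) * dist x y :=
    dist_le_mul_of_norm_fderiv_le hud hB0b
  have hS0b : ∀ x, ‖u x‖ ≤ (S0 : ℝ) := by
    intro x
    have hH : HolderWith B0 1 u := (LipschitzWith.of_dist_le_mul fun x y => hL0 x y).holderWith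
    calc ‖u x‖ ≤ B0 * (2 * ρ) ^ (((1 : ℝ≥0) : ℝ)) := norm_le_of_holderWith_of_eq_zero hH hρ hz0 x
      _ = (S0 : ℝ) := by rw [NNReal.coe_one, Real.rpow_one, hS0]; push_cast; rw [hρn_coe]; ring
  have hH0b : HolderWith H0 α u := holderWith_of_dist_le_mul_of_norm_le hα1 hL0 hS0b
  have hM2 : ∀ x, ‖iteratedFDeriv ℝ 2 u x‖ ≤ (Fintype.card ι : ℝ) ^ 2 * (S2 : ℝ) := fun x =>
    norm_iteratedFDeriv_two_le_of_apply_le bE u x (NNReal.coe_nonneg _) fun i j => hS2b i j x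
  -- Step 4: freezing — the Hölder constants of the perturbation terms
  have hR1 : ∀ i j, HolderWith (Ka * ρα * C' + Ka * S2) α
      (fun x => (a i j x - a i j x₀) * iteratedFDeriv ℝ 2 u x ![bE i, bE j]) := by
    intro i j
    refine holderWith_mul_of_eq_zero (s := ball x₀ ρ) ?_ ?_ (hC' i j) (hS2b i j) (hz2 i j)
    · intro x hx
      rw [← dist_eq_norm]
      calc dist (a i j x) (a i j x₀) ≤ Ka * dist x x₀ ^ (α : ℝ) := (haH i j).dist_le hx hx₀
        _ ≤ Ka * ρ ^ (α : ℝ) := by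
            gcongr
            exact (mem_ball.1 hx).le
        _ = ((Ka * ρα : ℝ≥0) : ℝ) := by push_cast; rw [hρα_coe]
    · intro x hx y hy
      rw [edist_sub_right]
      exact haH i j x hx y hy
  have hR2 : ∀ l', HolderWith (Kb * H1 + Kb * S1) α (fun x => b l' x * fderiv ℝ u x (bE l')) :=
    fun l' => holderWith_mul_of_eq_zero (s := ball x₀ ρ) (hb0 l') (hbH l') (hH1b l') (hS1b l') (hzφ l')
  have hR3 : HolderWith (Kc * H0 + Kc * S0) α (fun x => c x * u x) :=
    holderWith_mul_of_eq_zero (s := ball x₀ ρ) hc0 hcH hH0b hS0b hz0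
  set CR : ℝ≥0 := (∑ _i : ι, ∑ _j : ι, (Ka * ρα * C' + Ka * S2)) + (∑ _l : ι, (Kb * H1 + Kb * S1)) +
    (Kc * H0 + Kc * S0) with hCR
  have hR : HolderWith CR α (fun x =>
      (∑ i, ∑ j, (a i j x - a i j x₀) * iteratedFDeriv ℝ 2 u x ![bE i, bE j]) +
      (∑ l', b l' x * fderiv ℝ u x (bE l')) + c x * u x) := by
    have h1 : HolderWith (∑ _i : ι, ∑ _j : ι, (Ka * ρα * C' + Ka * S2)) α
        (fun x => ∑ i, ∑ j, (a i j x - a i j x₀) * iteratedFDeriv ℝ 2 u x ![bE i, bE j]) :=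
      holderWith_finset_sum (f := fun i x => ∑ j, (a i j x - a i j x₀) *
        iteratedFDeriv ℝ 2 u x ![bE i, bE j]) _ fun i _ =>
          holderWith_finset_sum (f := fun j x => (a i j x - a i j x₀) *
            iteratedFDeriv ℝ 2 u x ![bE i, bE j]) _ fun j _ => hR1 i j
    have h2 : HolderWith (∑ _l : ι, (Kb * H1 + Kb * S1)) α
        (fun x => ∑ l', b l' x * fderiv ℝ u x (bE l')) :=
      holderWith_finset_sum (f := fun l' x => b l' x * fderiv ℝ u x (bE l')) _ fun l' _ => hR2 l'
    exact (h1.add h2).add hR3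
  -- the frozen operator `f = P u - R`
  have hfeq : (fun x => ∑ i, ∑ j, a i j x₀ * iteratedFDeriv ℝ 2 u x ![bE i, bE j]) = fun x =>
      ((∑ i, ∑ j, a i j x * iteratedFDeriv ℝ 2 u x ![bE i, bE j]) +
        (∑ l', b l' x * fderiv ℝ u x (bE l')) + c x * u x) -
      ((∑ i, ∑ j, (a i j x - a i j x₀) * iteratedFDeriv ℝ 2 u x ![bE i, bE j]) +
        (∑ l', b l' x * fderiv ℝ u x (bE l')) + c x * u x) := by
    funext x
    simp only [sub_mul, Finset.sum_sub_distrib]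
    ring
  have hf : HolderWith (CP + CR) α (fun x => ∑ i, ∑ j, a i j x₀ * iteratedFDeriv ℝ 2 u x ![bE i, bE j]) := by
    rw [hfeq]
    exact holderWith_sub hP hR
  -- Step 5: the constant-coefficient estimate for the frozen operator
  have hB := hB2 (fun i j => a i j x₀) (fun i j => hsymm i j x₀) (hlow x₀ hx₀) (hup x₀ hx₀) u S0 B0 _
    (CP + CR) hu hS0b hB0b hM2 hf p q
  refine hB.mono ?_
  rw [Real.toNNReal_coe]
  -- Step 6: the bookkeeping `C₂ (S0 + CP + CR) ≤ C₂ CP + C'/2`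
  have hθ0 : (0 : ℝ) ≤ θ := NNReal.coe_nonneg _
  have hn0 : (0 : ℝ) ≤ n := NNReal.coe_nonneg _
  have hS1le : (S1 : ℝ) ≤ 4 * n * θ := by
    rw [hS1, hB1, hS2]; push_cast; rw [hρn_coe]
    nlinarith [mul_nonneg hn0 hθ0]
  have hB0le : (B0 : ℝ) ≤ 4 * n ^ 2 * θ := by
    rw [hB0]; push_cast; nlinarith [hS1le, hn0]
  have hS0le : (S0 : ℝ) ≤ 8 * n ^ 2 * θ := by
    rw [hS0]; push_cast; rw [hρn_coe]
    have : (0 : ℝ) ≤ B0 := NNReal.coe_nonneg _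
    nlinarith [hB0le]
  have hH1le : (H1 : ℝ) ≤ 10 * n * θ := by
    rw [hH1, hB1, hS2]; push_cast; nlinarith [hS1le]
  have hH0le : (H0 : ℝ) ≤ 20 * n ^ 2 * θ := by
    rw [hH0]; push_cast; nlinarith [hB0le, hS0le]
  have hKa : (0 : ℝ) ≤ Ka := NNReal.coe_nonneg _
  have hKb : (0 : ℝ) ≤ Kb := NNReal.coe_nonneg _
  have hKc : (0 : ℝ) ≤ Kc := NNReal.coe_nonneg _
  have hCRle : (S0 : ℝ) + CR ≤ n ^ 2 * θ * (8 + 3 * Ka + 14 * Kb + 28 * Kc) := by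
    have e : (CR : ℝ) = n * (n * (Ka * θ + Ka * (2 * θ))) + n * (Kb * H1 + Kb * S1) +
        (Kc * H0 + Kc * S0) := by
      rw [hCR]; push_cast
      simp only [Finset.sum_const, Finset.card_univ, nsmul_eq_mul, hn, hS2, hθ]
      push_cast; ring
    rw [e]
    calc (S0 : ℝ) + (n * (n * (Ka * θ + Ka * (2 * θ))) + n * (Kb * H1 + Kb * S1) + (Kc * H0 + Kc * S0))
        ≤ 8 * n ^ 2 * θ + (n * (n * (Ka * θ + Ka * (2 * θ))) + n * (Kb * (10 * n * θ) + Kb * (4 * n * θ)) +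
            (Kc * (20 * n ^ 2 * θ) + Kc * (8 * n ^ 2 * θ))) := by
          gcongr
      _ = n ^ 2 * θ * (8 + 3 * Ka + 14 * Kb + 28 * Kc) := by ring
  rw [← NNReal.coe_le_coe]
  push_cast
  have hθeq : (θ : ℝ) = ρ ^ (α : ℝ) * C' := by rw [hθ]; push_cast; rw [hρα_coe]
  have hC2 : (0 : ℝ) ≤ C₂ := NNReal.coe_nonneg _
  have hC'0 : (0 : ℝ) ≤ C' := NNReal.coe_nonneg _
  have hncard : (n : ℝ) = (Fintype.card ι : ℝ) := by rw [hn]; push_cast; rfl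
  calc (C₂ : ℝ) * (S0 + (CP + CR)) = C₂ * CP + C₂ * (S0 + CR) := by ring
    _ ≤ C₂ * CP + C₂ * (n ^ 2 * θ * (8 + 3 * Ka + 14 * Kb + 28 * Kc)) := by gcongr
    _ = C₂ * CP + (C₂ * (Fintype.card ι : ℝ) ^ 2 * (8 + 3 * Ka + 14 * Kb + 28 * Kc) * ρ ^ (α : ℝ)) * C' := by
        rw [hθeq, hncard]; ring
    _ ≤ C₂ * CP + (1 / 2) * C' := by gcongr
    _ = C₂ * CP + C' / 2 := by ring

/-- **The local Schauder estimate for variable coefficients** (freezing, Gilbarg–Trudinger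
Lemma 6.1 / Thm. 6.2, compactly supported form). For an orthonormal basis `e`, `0 < α < 1`,
`0 < λ`, `Λ` and Hölder bounds `K_a, K_b, K_c` there are `ρ₀ > 0` and `C` such that: for every
`0 < ρ ≤ ρ₀`, every operator `P u = ∑ᵢⱼ aⁱʲ D²u(eᵢ,eⱼ) + ∑ₗ bˡ Du(eₗ) + c u` with symmetric
`λ`-`Λ`-elliptic `a` on `B(x₀, ρ)`, `[aⁱʲ]_{α,B} ≤ K_a`, `|bˡ|, [bˡ]_{α,B} ≤ K_b`, `|c|, [c]_{α,B} ≤ K_c`,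
and every `u ∈ C^{2,α}` with `tsupport u ⊆ B(x₀, ρ)`: `[D²u(e_p, e_q)]_α ≤ C [P u]_α`.
[cite: GilbargTrudinger2001, Thm. 6.2] -/
theorem exists_schauder_local (bE : OrthonormalBasis ι ℝ E) {α : ℝ≥0} (hα0 : 0 < α) (hα1 : α < 1)
    {l : ℝ} (hl : 0 < l) (L : ℝ) (Ka Kb Kc : ℝ≥0) :
    ∃ ρ₀ : ℝ, 0 < ρ₀ ∧ ∃ C : ℝ≥0, ∀ ρ : ℝ, 0 < ρ → ρ ≤ ρ₀ →
      ∀ (a : ι → ι → E → ℝ) (b : ι → E → ℝ) (c : E → ℝ) (x₀ : E),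
        (∀ i j x, a i j x = a j i x) →
        (∀ x ∈ ball x₀ ρ, ∀ ξ : ι → ℝ, l * ∑ i, ξ i ^ 2 ≤ ∑ i, ∑ j, a i j x * ξ i * ξ j) →
        (∀ x ∈ ball x₀ ρ, ∀ ξ : ι → ℝ, ∑ i, ∑ j, a i j x * ξ i * ξ j ≤ L * ∑ i, ξ i ^ 2) →
        (∀ i j, HolderOnWith Ka α (a i j) (ball x₀ ρ)) →
        (∀ l' x, x ∈ ball x₀ ρ → ‖b l' x‖ ≤ Kb) → (∀ l', HolderOnWith Kb α (b l') (ball x₀ ρ)) →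
        (∀ x ∈ ball x₀ ρ, ‖c x‖ ≤ Kc) → HolderOnWith Kc α c (ball x₀ ρ) →
        ∀ (u : E → ℝ) (CH CP : ℝ≥0), ContDiff ℝ 2 u →
          (∀ i j, HolderWith CH α (fun x => iteratedFDeriv ℝ 2 u x ![bE i, bE j])) →
          tsupport u ⊆ ball x₀ ρ →
          HolderWith CP α (fun x => (∑ i, ∑ j, a i j x * iteratedFDeriv ℝ 2 u x ![bE i, bE j]) +
            (∑ l', b l' x * fderiv ℝ u x (bE l')) + c x * u x) →
          ∀ p q, HolderWith (C * CP) α (fun x => iteratedFDeriv ℝ 2 u x ![bE p, bE q]) := by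
  have hα0' : (0 : ℝ) < α := hα0
  have hαne : (α : ℝ) ≠ 0 := hα0'.ne'
  -- the constant-coefficient estimate, in `ℝ≥0` form
  obtain ⟨C₂, hC₂top, hC₂⟩ := exists_schauder_const_coeff bE hα0 hα1 hl (L := L)
  have hB2 : ∀ (A : Matrix ι ι ℝ), (∀ i j, A i j = A j i) →
      (∀ ξ : ι → ℝ, l * ∑ i, ξ i ^ 2 ≤ ∑ i, ∑ j, A i j * ξ i * ξ j) →
      (∀ ξ : ι → ℝ, ∑ i, ∑ j, A i j * ξ i * ξ j ≤ L * ∑ i, ξ i ^ 2) →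
      ∀ (u : E → ℝ) (M₀ M₁ M₂ : ℝ) (CL : ℝ≥0), ContDiff ℝ 2 u → (∀ x, ‖u x‖ ≤ M₀) →
        (∀ x, ‖fderiv ℝ u x‖ ≤ M₁) → (∀ x, ‖iteratedFDeriv ℝ 2 u x‖ ≤ M₂) →
        HolderWith CL α (fun x => ∑ i, ∑ j, A i j * iteratedFDeriv ℝ 2 u x ![bE i, bE j]) →
        ∀ p q, HolderWith (C₂.toNNReal * (M₀.toNNReal + CL)) α
          (fun x => iteratedFDeriv ℝ 2 u x ![bE p, bE q]) := by
    intro A hsymm hlow hup u M₀ M₁ M₂ CL hu h0 h1 h2 hH p q x y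
    have h := hC₂ A hsymm hlow hup u M₀ M₁ M₂ CL hu h0 h1 h2 hH p q x y
    rwa [← ENNReal.coe_toNNReal hC₂top.ne, ENNReal.ofReal, ← ENNReal.coe_add, ← ENNReal.coe_mul] at h
  -- the radius
  set K : ℝ := (C₂.toNNReal : ℝ) * (Fintype.card ι : ℝ) ^ 2 * (8 + 3 * Ka + 14 * Kb + 28 * Kc) with hK
  have hK0 : 0 ≤ K := by positivity
  set t : ℝ := 1 / (2 * K + 1) with ht
  have ht0 : 0 < t := by positivity
  set ρ₀ : ℝ := min 1 (t ^ (1 / (α : ℝ))) with hρ₀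
  refine ⟨ρ₀, lt_min one_pos (Real.rpow_pos_of_pos ht0 _), 2 * C₂.toNNReal, ?_⟩
  intro ρ hρ hρle a b c x₀ hsymm hlow hup haH hb0 hbH hc0 hcH u CH CP hu hCH hsupp hP
  have hρ1 : ρ ≤ 1 := hρle.trans (min_le_left _ _)
  have hsmall : K * ρ ^ (α : ℝ) ≤ 1 / 2 := by
    have hρt : ρ ^ (α : ℝ) ≤ t := by
      have h1 : ρ ≤ t ^ (1 / (α : ℝ)) := hρle.trans (min_le_right _ _)
      calc ρ ^ (α : ℝ) ≤ (t ^ (1 / (α : ℝ))) ^ (α : ℝ) := Real.rpow_le_rpow hρ.le h1 hα0'.le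
        _ = t := by rw [← Real.rpow_mul ht0.le, one_div_mul_cancel hαne, Real.rpow_one]
    calc K * ρ ^ (α : ℝ) ≤ K * t := by gcongr
      _ = K / (2 * K + 1) := by rw [ht]; ring
      _ ≤ 1 / 2 := by
          rw [div_le_iff₀ (by positivity)]
          linarith
  have hstep : ∀ C' : ℝ≥0,
      (∀ k : ι × ι, HolderWith C' α (fun x => iteratedFDeriv ℝ 2 u x ![bE k.1, bE k.2])) →
      ∀ k : ι × ι, HolderWith (C₂.toNNReal * CP + C' / 2) α
        (fun x => iteratedFDeriv ℝ 2 u x ![bE k.1, bE k.2]) := by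
    intro C' hC' k
    exact schauder_local_step bE hα1.le hB2 hρ hρ1 (by rw [hK] at hsmall; exact hsmall) a b c x₀
      hsymm hlow hup haH hb0 hbH hc0 hcH u hu hsupp hP (fun i j => hC' (i, j)) k.1 k.2
  intro p q
  have h := holderWith_of_forall_imp_half
    (f := fun k : ι × ι => fun x => iteratedFDeriv ℝ 2 u x ![bE k.1, bE k.2])
    (fun k => hCH k.1 k.2) hstep (p, q)
  simpa only [mul_assoc] using h

end Local

end Literature.Analysis.FunctionSpaces

end
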